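import Summits.HodgeConjecture.HodgeConjecture.Theorems.F0LD2ZVanOfOperatorWords
import Summits.HodgeConjecture.HodgeConjecture.Theorems.F0LD2SoftRoadZBricks
import Literature.NumberTheory.GelbartRogawski1991.LocalDoubledTwistedSectionUnipotentWord
import Literature.NumberTheory.GelbartRogawski1991.LocalDoubledTwistedSectionWeylWord
import Literature.NumberTheory.GelbartRogawski1991.LocalDoubledSiegelUnipotentCentreAnisotropic
import Literature.NumberTheory.Automorphic.AddCharConductorExponent
import HarnessLib

-- buildfix G11b-3 recipe (LEDGER B13-1/B13-3): elaborate sequentially.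
set_option Elab.async false

/-!
# Crux `HLiu418`, line LD2, soft road (π3): THE OPERATOR WORDS HOLD, hence (Z-van) `ZVan` HOLDS

Cell `hodgecm-mathlib` (D-0151), half A line LD2 (crux hLiu418 = `stmt-HodgeConjecture-24832`; organ `LineThetaTypesComplementary₁`; soft-road junction
of LD2-plan (g3): `(Z) ⟸ (Z-Λ) ∧ (Z-van)`, ★ `Theorems/F0LD2LineThetaTypesComplementary1.lineThetaTypesComplementary₁_of_zVan : ZVan → LineThetaTypesComplementary₁`).
This file DISCHARGES the hypothesis (OPW) of the mover-agnostic junction ★ `zVan_of_operatorWords` (★ `Theorems/F0LD2ZVanOfOperatorWords`) and concludes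
**`zVan_holds : ZVan`** (★ `Theorems/F0LD2SoftRoadZBricks.ZVan`, B-p04 (g45)).  KERNEL ONLY: theorems; no definition, no instance, no named fact, no `sorry`.

THE ASSEMBLY (`operatorWords_holds`).  Over the binder prefix of ‹ZVan› (`L` CM, `v` a finite place of `L⁺` INERT in `L` (`hE`), the anisotropic plane
`T = T₁ ⊕ αT₁` with `(−α⁻¹, δ²)_v = −1` (`hclass`), a splitting character `χ`, the standard doubled line `G₁ = localPi L c̄ (1+1) JD₁ v`):
* the conductor exponent `m` of `ψ_v` (★ `AddChar.IsContinuousNontrivial.exists_hasConductorExp`);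
* ONE mover `E″ ∈ Sp(𝕎^𝔻_v)` with `E″ ℓ_Δ = ℓ_Y` and `B′ ∈ GL_{2+2}(L⁺_v)` carrying the WEYL WORD for every implementer of `E″` (★ B-p08 (g36)
  `LocalDoubledTwistedSectionWeylWord.exists_mover_weylWord`, over ★ LD2-p01 (g3) `LocalDoubledWeylElementCayleyMover`); the implementer `Γ := r^𝔻(E″)` of the
  datum's own section; `w := weylDelta L⁺ L c̄ v 1 hJD₁`, `A := leviOpPi (glEquiv B′)`, `κ := (modSqrt (glEquiv B′).symm)⁻¹` (★ `coe_leviOpPi_apply`);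
* the skew non-zero scalar `τ := δ ⊗ 1 ∈ L ⊗ L⁺_v` (★ `conjLocal_algebraMap`, `complexConj_imagUnit`), the Rao parameter `c₀ := cOfFix 𝕋 (E″ ι_D(n₂(τ·1)) E″⁻¹)`,
  ANISOTROPIC (★ B-p04 (g45) `LocalDoubledSiegelUnipotentCentreAnisotropic.halfForm_cOfFix_mover_conj_nElem_anisotropic_of_hilbertSymbol`, over ★ LD2-p02 (g3)
  `LocalDoubledSiegelUnipotentAnisotropy` and ★ B-p08 (g36) (AN-core) `Liu2021.AnisotropicPlaneNormFormOfHilbertSymbol`), and the one-parameter family of Siegel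
  unipotents `n b := nElem L⁺ L c̄ v 1 hJD₁ ((b·τ) • 1) _` with the EXACT UNIPOTENT WORD `s′(n b) = Γ⁻¹ ∘ unipOpPi (b • c₀ ·) ∘ Γ` (★ A-p19 (g31)
  `LocalDoubledTwistedSectionUnipotentWord.twistedSection_kronLoc_nElem_smul_apply_eq_conj_unipOpPi_smul`, over ★ LD2-p02 (g3) `LocalDoubledSiegelUnipotentMover` ∕
  `LocalDoubledSiegelUnipotentDetOne`, ★ LD2-p01 (g3) `LocalDoubledTwistedSectionEigenlaw` ∕ `LocalDoubledSiegelParabolicModularCharacter`, ★ A-p16 (g35)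
  `LocalSchrodingerWeylFourierTwin`).
Then `zVan_holds := zVan_of_operatorWords operatorWords_holds` (the MVW kernel ★ `SBInvariantFunctionalVanishesOfConjugateModel`).

[MoeglinVignerasWaldspurger1987] Chap. 2 II.1–II.2, II.6; Chap. 3 §IV.4 · [Kudla1994] §3 Thm. 3.1 · [HarrisKudlaSweet1996] §1 (1.15), §6 Thm. 6.1 ·
[Rangarao1993] Lemma 3.2 (3.8), Thm. 3.5 · [GelbartRogawski1991] §3.2 (3.2.2)–(3.2.3) p. 457.
HONEST LABEL: nothing of print is asserted; HC_CM is proved only modulo the 7 printed citations (2 remaining: hLiu418 = stmt-HodgeConjecture-24832,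
h413 = stmt-HodgeConjecture-24833) until rung 0 closes; count-neutral.
-/

set_option autoImplicit false

noncomputable section

open scoped Matrix Kronecker
open NumberField IsDedekindDomain MeasureTheory MeasureTheory.Measure
open Literature.NumberTheory Literature.NumberTheory.Automorphic Literature.NumberTheory.Automorphic.UnitaryGroup
open Literature.RepresentationTheory Literature.RepresentationTheory.HeisenbergGroup Literature.RepresentationTheory.TwistedCoinv
open Literature.RepresentationTheory.HeisenbergGroup.SymplecticMatrix
open Literature.NumberTheory.GelbartRogawski1991 Literature.NumberTheory.GelbartRogawski1991.UnitaryDualPair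
open Literature.NumberTheory.GelbartRogawski1991.UnitaryDualPair.WeilCoinv
open Literature.NumberTheory.GelbartRogawski1991.UnitaryDualPair.LocalSplitting
open Literature.NumberTheory.GelbartRogawski1991.GRConstruction
open Literature.NumberTheory.Weil1964
open Literature.NumberTheory.GaloisRepresentations Literature.RepresentationTheory.HarrisKudlaSweet1996
open Literature.RepresentationTheory.MoeglinVignerasWaldspurger1987
open Literature.NumberTheory.QuadraticForms


namespace Summit.HodgeConjecture.HodgeConjecture.Cruxes.HLiu418.F0LD2SoftRoadJunction

set_option linter.dupNamespace false

set_option synthInstance.maxHeartbeats 400000 in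
set_option maxHeartbeats 4000000 in -- the doubled CM datum's telescope
/-- **(OPW) THE OPERATOR WORDS HOLD** — the hypothesis of ★ `zVan_of_operatorWords`, assembled from the exact unipotent word (★ `LocalDoubledTwistedSectionUnipotentWord`),
the Weyl word (★ `LocalDoubledTwistedSectionWeylWord`), the anisotropy of the Rao parameter (★ `LocalDoubledSiegelUnipotentCentreAnisotropic`) and the value of
`leviOpPi⁻¹` at `0` (★ `coe_leviOpPi_apply`), for ONE mover `E″` and the datum's own implementer `Γ = r^𝔻(E″)`.
[cite: Kudla1994, §3 Thm. 3.1] [cite: MoeglinVignerasWaldspurger1987, Chap. 2 II.1 (A)–(B), II.6] [cite: Rangarao1993, Lemma 3.2 (3.8), Thm. 3.5]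
[cite: HarrisKudlaSweet1996, §1 (1.15)] -/
theorem operatorWords_holds :
    ∀ (L : Type) [Field L] [NumberField L] [IsCMField L] (v : HeightOneSpectrum (𝓞 (maximalRealSubfield L)))
      [MeasurableSpace (v.adicCompletion (maximalRealSubfield L))] [BorelSpace (v.adicCompletion (maximalRealSubfield L))]
      (μ : Measure (v.adicCompletion (maximalRealSubfield L))) [μ.IsAddHaarMeasure]
      (hE : IsField (UnitaryGroup.LocalRing L v))
      {T₁ T₂ : Matrix (Fin 1) (Fin 1) (maximalRealSubfield L)} (hT₁ : T₁.IsSymm) (hT₂ : T₂.IsSymm) (hT₁d : IsUnit T₁.det) (hT₂d : IsUnit T₂.det)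
      (α : (maximalRealSubfield L)ˣ) (hTT' : T₂ = (α : maximalRealSubfield L) • T₁)
      (hclass : hilbertSymbol (v.adicCompletion (maximalRealSubfield L))
        ((-(α : maximalRealSubfield L)⁻¹ : maximalRealSubfield L) : v.adicCompletion (maximalRealSubfield L))
        ((imagUnitSq L : maximalRealSubfield L) : v.adicCompletion (maximalRealSubfield L)) = -1)
      {T : Matrix (Fin (1 + 1)) (Fin (1 + 1)) (maximalRealSubfield L)} (hT : T = UnitaryGroup.finSum 1 1 T₁ T₂) (hTs : T.IsSymm) (hTd : IsUnit T.det)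
      (χ : HeckeCharacter L) (hχ : IsSplittingChar L 1 χ)
      {JD₁ : Matrix (Fin (1 + 1)) (Fin (1 + 1)) L}
      (hJD₁ : JD₁ = (gramD (maximalRealSubfield L) 1 1).map (algebraMap (maximalRealSubfield L) L)),
        ∃ (Γ : SchwartzBruhat (Fin (2 + 2) → v.adicCompletion (maximalRealSubfield L)) ≃ₗ[ℂ]
            SchwartzBruhat (Fin (2 + 2) → v.adicCompletion (maximalRealSubfield L)))
          (c₀ : Matrix (Fin (2 + 2)) (Fin (2 + 2)) (v.adicCompletion (maximalRealSubfield L)))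
          (n : v.adicCompletion (maximalRealSubfield L) → UnitaryGroup.localPi L (IsCMField.complexConj L) (1 + 1) JD₁ v)
          (w : UnitaryGroup.localPi L (IsCMField.complexConj L) (1 + 1) JD₁ v)
          (A : SchwartzBruhat (Fin (2 + 2) → v.adicCompletion (maximalRealSubfield L)) ≃ₗ[ℂ]
            SchwartzBruhat (Fin (2 + 2) → v.adicCompletion (maximalRealSubfield L)))
          (κ γ : ℂ) (m : ℤ) (hm : (adeleAddCharAt (maximalRealSubfield L) v).HasConductorExp m),
          (∀ x : Fin (2 + 2) → v.adicCompletion (maximalRealSubfield L), halfForm (Matrix.mulVecLin c₀) x = 0 → x = 0) ∧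
          (∀ (b : v.adicCompletion (maximalRealSubfield L)) (Ψ : SchwartzBruhat (Fin (2 + 2) → v.adicCompletion (maximalRealSubfield L))),
            (((localMu L χ v (Matrix.GeneralLinearGroup.det ((localPiEquiv L (IsCMField.complexConj L) (1 + 1) JD₁ v (n b)).1)))⁻¹ : ℂˣ) : ℂ) •
            MpPsi.toRep (localSchrodinger (maximalRealSubfield L) (2 + 2) (gramD (maximalRealSubfield L) 2 T) v)
              ((localSplittingDatumCM L v μ 2 hTs hTd rfl χ hχ).localSplitting
                (kronLoc (maximalRealSubfield L) L (IsCMField.complexConj L) v 2 (T := T) (J := T.map (algebraMap (maximalRealSubfield L) L))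
                  rfl rfl hJD₁ (n b))) Ψ =
              Γ.symm (unipOpPi (isLocallyConstant_of_isContinuousNontrivial (isContinuousNontrivial_adeleAddCharAt (maximalRealSubfield L) v))
                (b • Matrix.mulVecLin c₀) (Γ Ψ))) ∧
          (∀ g : SchwartzBruhat (Fin (2 + 2) → v.adicCompletion (maximalRealSubfield L)),
            ((A.symm g : SchwartzBruhat (Fin (2 + 2) → v.adicCompletion (maximalRealSubfield L))) :
                (Fin (2 + 2) → v.adicCompletion (maximalRealSubfield L)) → ℂ) 0 =
              κ * (g : (Fin (2 + 2) → v.adicCompletion (maximalRealSubfield L)) → ℂ) 0) ∧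
          (∀ Ψ : SchwartzBruhat (Fin (2 + 2) → v.adicCompletion (maximalRealSubfield L)),
            (((localMu L χ v (Matrix.GeneralLinearGroup.det ((localPiEquiv L (IsCMField.complexConj L) (1 + 1) JD₁ v w).1)))⁻¹ : ℂˣ) : ℂ) •
            MpPsi.toRep (localSchrodinger (maximalRealSubfield L) (2 + 2) (gramD (maximalRealSubfield L) 2 T) v)
              ((localSplittingDatumCM L v μ 2 hTs hTd rfl χ hχ).localSplitting
                (kronLoc (maximalRealSubfield L) L (IsCMField.complexConj L) v 2 (T := T) (J := T.map (algebraMap (maximalRealSubfield L) L))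
                  rfl rfl hJD₁ w)) Ψ =
              γ • Γ.symm (fourierOpPi μ (isContinuousNontrivial_adeleAddCharAt (maximalRealSubfield L) v) hm (A (Γ Ψ)))) := by
  intro L _ _ _ v _ _ μ _ hE T₁ T₂ hT₁ hT₂ hT₁d hT₂d α hTT' hclass T hT hTs hTd χ hχ JD₁ hJD₁
  -- the conductor exponent of `ψ_v`
  obtain ⟨m, hm⟩ := (isContinuousNontrivial_adeleAddCharAt (maximalRealSubfield L) v).exists_hasConductorExp
  -- ONE mover `E″` with the Weyl word for every implementer
  obtain ⟨E'', B', hE'', hWord⟩ := exists_mover_weylWord L v μ hTs hTd χ hχ hJD₁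
    (isUnit_det_localGram_gramD (maximalRealSubfield L) v 2 hTd) hm
  -- the datum's own implementer `Γ := r^𝔻(E″)`
  obtain ⟨γ, hγ⟩ := hWord ((localSplittingDatumCM L v μ 2 hTs hTd rfl χ hχ).r E'')
    ((localSplittingDatumCM L v μ 2 hTs hTd rfl χ hχ).r.implements E'')
  -- the skew non-zero scalar `τ := δ ⊗ 1`
  have hτ : conjLocal L (IsCMField.complexConj L) v (algebraMap L (UnitaryGroup.LocalRing L v) (imagUnit L)) =
      -algebraMap L (UnitaryGroup.LocalRing L v) (imagUnit L) := by
    rw [conjLocal_algebraMap, complexConj_imagUnit, map_neg]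
  haveI := hE.nontrivial
  have hτ0 : algebraMap L (UnitaryGroup.LocalRing L v) (imagUnit L) ≠ 0 := (map_ne_zero _).2 (imagUnit_ne_zero L)
  refine ⟨(localSplittingDatumCM L v μ 2 hTs hTd rfl χ hχ).r E'',
    cOfFix (localGram (maximalRealSubfield L) (2 + 2) (gramD (maximalRealSubfield L) 2 T) v)
      (E'' * iotaD (maximalRealSubfield L) L (IsCMField.complexConj L) (complexConj_imagUnit L) (imagUnit_ne_zero L)
        (imagUnit_mul_self L) v 2 hTs rfl
          (nElem (maximalRealSubfield L) L (IsCMField.complexConj L) v 2 (T₀ := T) rfl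
            (algebraMap L (UnitaryGroup.LocalRing L v) (imagUnit L) • 1)
            (skew_smul_one (maximalRealSubfield L) L (IsCMField.complexConj L) v 2 _ hτ)) * E''⁻¹),
    fun b => nElem (maximalRealSubfield L) L (IsCMField.complexConj L) v 1 hJD₁
      ((b • algebraMap L (UnitaryGroup.LocalRing L v) (imagUnit L)) • 1)
      (skew_smul_one (maximalRealSubfield L) L (IsCMField.complexConj L) v 1 _ (skew_smul L v b _ hτ)),
    weylDelta (maximalRealSubfield L) L (IsCMField.complexConj L) v 1 hJD₁,
    leviOpPi (glEquiv B'), ((modSqrt (glEquiv B').symm : ℂ))⁻¹, γ, m, hm,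
    halfForm_cOfFix_mover_conj_nElem_anisotropic_of_hilbertSymbol L v hT₁d α hTT' hclass hT hTs E'' hE'' _ hτ hτ0,
    fun b Ψ => twistedSection_kronLoc_nElem_smul_apply_eq_conj_unipOpPi_smul L v μ hTs hTd χ hχ hJD₁ E'' hE'' _
      ((localSplittingDatumCM L v μ 2 hTs hTd rfl χ hχ).r.implements E'') _ hτ b Ψ,
    fun g => ?_, hγ⟩
  -- `(leviOpPi a)⁻¹ = leviOpPi a⁻¹` reads the value at `0` up to `|det a|^{1/2}`
  have h1 : (leviOpPi (glEquiv B')).symm g = leviOpPi (glEquiv B').symm g := by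
    rw [leviOpPi_symm, LinearEquiv.coe_inv]
  rw [h1, coe_leviOpPi_apply, map_zero]

/-- **(Z-van) `ZVan` HOLDS** — every linear functional on `𝒮(L⁺_v^{2+2})` invariant under the twisted doubled Weil section of the standard doubled line vanishes
(★ `zVan_of_operatorWords` at `operatorWords_holds`): the brick `stub_brick_zVan` of both LD leaves, and with ★ `zLambda_body` the organ
`LineThetaTypesComplementary₁` (★ `lineThetaTypesComplementary₁_of_zVan`). [cite: MoeglinVignerasWaldspurger1987, Chap. 2 II.1–II.2; Chap. 3 §IV.4]
[cite: Kudla1994, §3 Thm. 3.1] [cite: HarrisKudlaSweet1996, §6 Thm. 6.1] [cite: GelbartRogawski1991, §3.2 (3.2.2)–(3.2.3) p. 457] -/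
theorem zVan_holds : ZVan :=
  zVan_of_operatorWords operatorWords_holds

end Summit.HodgeConjecture.HodgeConjecture.Cruxes.HLiu418.F0LD2SoftRoadJunction

end
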